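import Summits.NavierStokesRegularity.NavierStokesRegularity.Theorems.ScenarioCensusRowF1ax
import Summits.NavierStokesRegularity.NavierStokesRegularity.Theorems.TypeICertificateLadderRungZero
import Literature.Analysis.FluidPDE.BarkerPrange2020VorticityAlignmentTypeIHolds
import Literature.Analysis.FluidPDE.TypeIAncientMildTimeAnalytic
import HarnessLib
import Summits.NavierStokesRegularity.NavierStokesRegularity.Theorems.ScenarioCensusRowF1TwoTimeTopSignals
import Summits.NavierStokesRegularity.NavierStokesRegularity.Theorems.ScenarioCensusRowF1ColumnarTop

/-!
# Census row F1, the COMPACTNESS UPGRADE — criteria at ONE LEVEL `Λ₀(M, ·)` chosen before the solution (cells F1lv / F1td; floor OLF) — LINE 35 «one-level-top» port, part 1/3: §1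
# objects (dimensionless Type-I constant, lag, top — LINE 34's `lagTime` / `topSet` / `HasDisjointTops` / `Row_F1dj` BY NAME `TwoTimeTop.…`), the ONE-LEVEL row `Row_F1lv`, its residual
# and floor, the split `rowF1dj_of_rowF1lv`; §2 COMPACTNESS of `𝒦_M` and the SOCKET LEMMA; §3 the WINDOWED rest-point kill and the DJ LEVEL (signal lemmas BY NAME)

Re-homed for the scenario census (typer seat ns-census-typer-1 g9; the cells F1lv / F1td and the floor OLF are MEMBERS OF RECORD «DECIDED IN KERNEL IN FILES» of row F1 since
census v1.101 (item 73: critic PASS; ref ns-census-ref g13 PRE-CHECK ✓ §18.9; lead-presearch label); this port makes them TREE-decided): VERBATIM PORT of ns-idea-3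
LINE 35 «one-level-top», `pub/ideators/ns-idea-3/lines/one-level-top/line-one-level-top.lean` sha16 06846e90c67bb04b (874 l., lean check rc 0, 0 sorry), split for the
400-line rule into `ScenarioCensusRowF1OneLevelTop` (§1–§3) → `…OneLevelTopZoom` (§4) → `…OneLevelTopRows` (§5–§7 + census KEYS).  Lean text VERBATIM in namespace
`…Theorems.ScenarioCensus.OneLevelTop` (the line's `…Cruxes.ScenarioCensusRowF1.OneLevelTopLine` re-homed); port edits: LINE 34's VERBATIM restatements (`lagTime`, `topSet`,
`HasDisjointTops`, `Row_F1dj`, the signal lemmas, `rowF1dj_holds`) and LINE 15's `tendsto_physicalTime` are taken BY NAME from the landed two-time-top / columnar-top ports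
(`TwoTimeTop.…`, `ColumnarTop.…`); `@[conjecture]` on the residual `LevelCollapse` (≡ `ScenarioCensus.Row_F1`, OPEN); six one-line docstrings added (gate lint).
Statements untouched.

No census VALUE is moved here (row F1 stays OPEN-WITH-LINE; the members become TREE-decided by name); NS regularity is NOT proved; `Row_F1` is untouched (zero
movement, `levelCollapse_iff_rowF1`); no summit statement is proved by this file. Lemmas that restate already-landed tree declarations are taken BY NAME (gate lint `dedup.landed`): `rowF1dj_holds` = `TwoTimeTop.rowF1dj_holds`, `tendsto_physicalTime` = `ColumnarTop.tendsto_physicalTime`.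
-/

-- the summit and its single problem share the name `NavierStokesRegularity` (D-0017 nested layout)
set_option linter.dupNamespace false

noncomputable section

open MeasureTheory Set Function Filter TopologicalSpace Metric
open scoped Topology NNReal ENNReal

namespace Summit.NavierStokesRegularity.NavierStokesRegularity.Theorems.ScenarioCensus.OneLevelTop

open Literature.Analysis Literature.Analysis.FluidPDE
open Summit.NavierStokesRegularity.NavierStokesRegularity.Theorems
open Summit.NavierStokesRegularity.NavierStokesRegularity.Theses

/-- `ℝ³`. -/
abbrev E3 := EuclideanSpace ℝ (Fin 3)

/-! ## §1 Objects: dimensionless Type-I constant, lag, top; the ONE-LEVEL row, its residual and floor; the split -/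

/-- **Type I with DIMENSIONLESS constant `M`**: eventually `√(T − t)|u(t, x)| ≤ M√ν` for every `x` (the scaling-covariant
form of `IsTypeIBlowup`, with the constant EXPOSED so that levels may depend on it). -/
def HasTypeIConstant (ν T M : ℝ) (u : ℝ → E3 → E3) : Prop :=
  ∀ᶠ t in 𝓝[<] T, ∀ x : E3, Real.sqrt (T - t) * ‖u t x‖ ≤ M * Real.sqrt ν

/-- A Type-I blow-up with a dimensionless constant is a Type-I blow-up. -/
theorem HasTypeIConstant.isTypeIBlowup {ν T M : ℝ} {u : ℝ → E3 → E3} (h : HasTypeIConstant ν T M u) :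
    IsTypeIBlowup u T := by
  refine ⟨M * Real.sqrt ν, ?_⟩
  have hlt : ∀ᶠ t in 𝓝[<] T, t < T := eventually_nhdsWithin_of_forall fun t ht => ht
  filter_upwards [h, hlt] with t ht htT x
  have hpos : 0 < Real.sqrt (T - t) := Real.sqrt_pos.2 (sub_pos.2 htT)
  rw [le_div_iff₀ hpos, mul_comm]
  exact ht x

/-- Every Type-I blow-up rate has a dimensionless constant (`M = C/√ν`). -/
theorem exists_hasTypeIConstant {ν T : ℝ} (hν : 0 < ν) {u : ℝ → E3 → E3} (h : IsTypeIBlowup u T) :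
    ∃ M : ℝ, HasTypeIConstant ν T M u := by
  obtain ⟨C, hC⟩ := h
  refine ⟨C / Real.sqrt ν, ?_⟩
  have hlt : ∀ᶠ t in 𝓝[<] T, t < T := eventually_nhdsWithin_of_forall fun t ht => ht
  filter_upwards [hC, hlt] with t ht htT y
  have hpos : 0 < Real.sqrt (T - t) := Real.sqrt_pos.2 (sub_pos.2 htT)
  rw [div_mul_cancel₀ _ (Real.sqrt_pos.2 hν).ne']
  calc Real.sqrt (T - t) * ‖u t y‖ ≤ Real.sqrt (T - t) * (C / Real.sqrt (T - t)) :=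
        mul_le_mul_of_nonneg_left (ht y) hpos.le
    _ = C := mul_div_cancel₀ C hpos.ne'

/-- **(DJ at ONE level)** disjoint tops of level `Λ` with lag `θ`: eventually no point is `Λ`-fast BOTH at `t` and at
`t − θ(T − t)`. (LINE 34 demanded this at EVERY level `Λ > 0`.) -/
def HasDisjointTopsAt (ν T θ Λ : ℝ) (u : ℝ → E3 → E3) : Prop :=
  ∀ᶠ t in 𝓝[<] T, Disjoint (TwoTimeTop.topSet ν T u Λ (TwoTimeTop.lagTime T θ t)) (TwoTimeTop.topSet ν T u Λ t)

/-- **Criterion row F1lv — ONE-LEVEL DISJOINT TOPS** (Type I with dimensionless constant `M` · disjoint tops of ONE level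
`Λ₀ = Λ₀(M, θ)` with lag `θ` · Clay ⇒ extension).  The level is chosen BEFORE `ν, T, u, p` (it depends on `M` and `θ` only;
it is ineffective).  PROVED (`rowF1lv_holds`). -/
def Row_F1lv : Prop :=
  ∀ θ M : ℝ, 0 < θ → ∃ Λ₀ : ℝ, 0 < Λ₀ ∧
    ∀ (ν T : ℝ), 0 < ν → 0 < T → ∀ (u : ℝ → E3 → E3) (p : ℝ → E3 → ℝ),
    IsClassicalNSSolutionOn (Ico 0 T) ν 0 u p → IsLerayHopfOn T ν 0 (u 0) u →
    HasRapidSpatialDecay (u 0) → HasTypeIConstant ν T M u → HasDisjointTopsAt ν T θ Λ₀ u →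
    HasSmoothExtensionPast ν 0 u T

/-- **Order theorem**: the one-level row implies LINE 34's all-levels row (take `M = C/√ν` and the level `Λ₀(M, θ)`). -/
theorem rowF1dj_of_rowF1lv (h : Row_F1lv) : TwoTimeTop.Row_F1dj := by
  intro ν T hν hT u p hsol hLH hdec hTI hH
  obtain ⟨θ, hθ, hH⟩ := hH
  obtain ⟨M, hM⟩ := exists_hasTypeIConstant hν hTI
  obtain ⟨Λ₀, hΛ₀, hrow⟩ := h θ M hθ
  exact hrow ν T hν hT u p hsol hLH hdec hM (hH Λ₀ hΛ₀)

/-! ## §2 MECHANISM, part 1 — COMPACTNESS of the limit class `𝒦_M` and the SOCKET LEMMA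

`𝒦_M` = `IsTypeIAncientMild M` (KNSS 2009: smooth, divergence free, Oseen-mild on the open past, `|W(s, y)| ≤ M/√(−s)`).
The tree's `C¹_loc` extraction theorem `exists_tendsto_of_typeI_seq_Ioo` (KNSS 2009, Lemma 6.1) is stated for zoom sequences
on growing windows; fed with MEMBERS of `𝒦_M` (windows `(−(n+1), 0)`) it is the sequential compactness of `𝒦_M` under pointwise
convergence on the open past.  No earlier line of this seat uses compactness of the class: every kill so far was EXACT. -/

/-- **Compactness of `𝒦_M`** (pointwise form): every sequence in `𝒦_M` has a subsequence converging at every point of the open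
past to a member of `𝒦_M`. -/
theorem limitClass_compact (M : ℝ) (Wn : ℕ → ℝ → E3 → E3) (h : ∀ n, IsTypeIAncientMild M (Wn n)) :
    ∃ φ : ℕ → ℕ, StrictMono φ ∧ ∃ W : ℝ → E3 → E3, IsTypeIAncientMild M W ∧
      ∀ t < 0, ∀ y : E3, Tendsto (fun j => Wn (φ j) t y) atTop (𝓝 (W t y)) := by
  set A : ℕ → ℝ := fun n => -((n : ℝ) + 1) with hA
  have hAlim : Tendsto A atTop atBot := by
    have h1 : Tendsto (fun n : ℕ => (n : ℝ) + 1) atTop atTop :=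
      tendsto_atTop_add_const_right _ _ tendsto_natCast_atTop_atTop
    exact tendsto_neg_atTop_atBot.comp h1
  have hsub : ∀ n, Ioo (A n) 0 ×ˢ (univ : Set E3) ⊆ Iio 0 ×ˢ univ := fun n =>
    prod_mono (fun t ht => ht.2) subset_rfl
  have hc : ∀ n, ContinuousOn (uncurry (Wn n)) (Ioo (A n) 0 ×ˢ univ) := fun n =>
    (h n).continuousOn_uncurry.mono (hsub n)
  have hdiv : ∀ n, ∀ t ∈ Ioo (A n) 0, IsWeaklyDivFree (Wn n t) := fun n t ht =>
    (h n).isWeaklyDivFree ht.2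
  have hmild : ∀ n, ∀ s t : ℝ, A n < s → s < t → t < 0 → ∀ x,
      Wn n t x = UnboundedOperators.heatExtension (Wn n s) (t - s) x -
        oseenDuhamel 1 s (Wn n) (Wn n) t x :=
    fun n s t _ hst ht x => (h n).mild_eq_heatExtension hst ht x
  have hI : ∀ n, ∀ t ∈ Ioo (A n) 0, ∀ x, ‖Wn n t x‖ ≤ M / Real.sqrt (-t) := fun n t ht x =>
    (h n).norm_le ht.2 x
  obtain ⟨φ, hφ, W, hW, hpt, -, -, -⟩ := exists_tendsto_of_typeI_seq_Ioo M hAlim hc hdiv hmild hI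
  exact ⟨φ, hφ, W, hW, hpt⟩

/-- **SOCKET LEMMA (the compactness upgrade).**  Let `P Λ W` be any «defect of `W` below `Λ`» predicate.  Suppose the
LIMIT KILL: whenever members `W_n ∈ 𝒦_M` with `P εₙ W_n`, `εₙ → 0⁺`, converge pointwise on the open past to `W ∈ 𝒦_M`, the limit
rests at `(−1, 0)`.  Then there is ONE LEVEL `Λ₁ = Λ₁(M, κ, P) > 0` such that no `W ∈ 𝒦_M` with `‖W(−1, 0)‖ ≥ κ` has defect
below `Λ₁`.  (Contradiction + compactness; `Λ₁` is ineffective.) -/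
theorem exists_level_of_limitKill (M : ℝ) {κ : ℝ} (hκ : 0 < κ) (P : ℝ → (ℝ → E3 → E3) → Prop)
    (hkill : ∀ (Wn : ℕ → ℝ → E3 → E3) (W : ℝ → E3 → E3) (ε : ℕ → ℝ),
      (∀ n, 0 < ε n) → Tendsto ε atTop (𝓝 0) → (∀ n, IsTypeIAncientMild M (Wn n)) → IsTypeIAncientMild M W →
      (∀ n, P (ε n) (Wn n)) → (∀ t < 0, ∀ y : E3, Tendsto (fun n => Wn n t y) atTop (𝓝 (W t y))) →
      W (-1) 0 = 0) :
    ∃ Λ₁ : ℝ, 0 < Λ₁ ∧ ∀ W : ℝ → E3 → E3, IsTypeIAncientMild M W → κ ≤ ‖W (-1) 0‖ → ¬ P Λ₁ W := by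
  by_contra hno
  -- for every level `1/(n+1)` a `κ`-normalised member of the class with defect below it
  have hex : ∀ n : ℕ, ∃ W : ℝ → E3 → E3,
      IsTypeIAncientMild M W ∧ κ ≤ ‖W (-1) 0‖ ∧ P (1 / ((n : ℝ) + 1)) W := by
    intro n
    by_contra hn
    exact hno ⟨1 / ((n : ℝ) + 1), by positivity, fun W hW hκW hP => hn ⟨W, hW, hκW, hP⟩⟩
  choose Wn hWn hκn hPn using hex
  -- compactness: a pointwise limit `W ∈ 𝒦_M` along a subsequence
  obtain ⟨φ, hφ, W, hW, hpt⟩ := limitClass_compact M Wn hWn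
  have hφt : Tendsto φ atTop atTop := hφ.tendsto_atTop
  set ε : ℕ → ℝ := fun j => 1 / ((φ j : ℝ) + 1) with hε
  have hεpos : ∀ j, 0 < ε j := fun j => by simp only [hε]; positivity
  have hεlim : Tendsto ε atTop (𝓝 0) := by
    have h1 : Tendsto (fun j => (φ j : ℝ) + 1) atTop atTop :=
      tendsto_atTop_add_const_right _ _ (tendsto_natCast_atTop_atTop.comp hφt)
    exact tendsto_const_nhds.div_atTop h1
  -- the limit kill: `W(−1, 0) = 0` …
  have hzero : W (-1) 0 = 0 :=
    hkill (fun j => Wn (φ j)) W ε hεpos hεlim (fun j => hWn (φ j)) hW (fun j => hPn (φ j))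
      (fun t ht y => hpt t ht y)
  -- … against the normalisation, which passes to the limit
  have hge : κ ≤ ‖W (-1) 0‖ :=
    ge_of_tendsto ((hpt (-1) (by norm_num) 0).norm) (Eventually.of_forall fun j => hκn (φ j))
  rw [hzero, norm_zero] at hge
  exact absurd hge (not_le.2 hκ)

/-! ## §3 MECHANISM, part 2 — the WINDOWED rest-point kill and the DJ LEVEL

The exact kill of LINE 34 (analytic rigidity of rest points: `W ∈ 𝒦_M` is real-analytic in time, tree
`IsTypeIAncientMild.analyticAt_time`) is LOCAL: it needs the rest-point alternative only on an open window of instants at ONE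
point.  Local exact kills are closed under pointwise limits, so they fit the socket. -/

/-- **WINDOWED KILL (DJ).**  If at one point `y` the signal of `W ∈ 𝒦_M` rests NOW or one lag EARLIER (`W(t, y) = 0` or
`W((1+θ)t, y) = 0`) at every instant `t` of some open window `(a, b)`, `a < b ≤ 0`, then `W(·, y) ≡ 0` on the open past. -/
theorem signal_eq_zero_of_disjoint_window {M θ : ℝ} {W : ℝ → E3 → E3} (hW : IsTypeIAncientMild M W)
    (hθ : 0 < θ) (y : E3) {a b : ℝ} (hab : a < b) (hb : b ≤ 0)
    (h : ∀ t ∈ Ioo a b, W ((1 + θ) * t) y = 0 ∨ W t y = 0) : ∀ t < 0, W t y = 0 := by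
  have hκ : 0 < 1 + θ := by linarith
  -- on the window the signal rests everywhere (else the lagged signal rests near a point: rigidity)
  have hwin : ∀ t ∈ Ioo a b, W t y = 0 := by
    intro t htI
    have ht0 : t < 0 := lt_of_lt_of_le htI.2 hb
    by_contra hne
    have hc : ContinuousAt (fun r : ℝ => W (1 * r) y) t := TwoTimeTop.continuousAt_signal hW y one_pos ht0
    simp only [one_mul] at hc
    have hev1 : ∀ᶠ s in 𝓝 t, W s y ≠ 0 := hc.eventually_ne hne
    have hev2 : ∀ᶠ s in 𝓝 t, s ∈ Ioo a b := Ioo_mem_nhds htI.1 htI.2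
    have hzero : ∀ᶠ s in 𝓝 t, W ((1 + θ) * s) y = 0 := by
      filter_upwards [hev1, hev2] with s hs hsI
      exact (h s hsI).resolve_right hs
    exact hne (TwoTimeTop.signal_eq_zero_of_eventually hW y hκ ht0 hzero t ht0)
  -- the window is a neighbourhood of its midpoint: rigidity again
  set t₀ : ℝ := (a + b) / 2 with ht₀
  have ht₀a : a < t₀ := by rw [ht₀]; linarith
  have ht₀b : t₀ < b := by rw [ht₀]; linarith
  have ht₀0 : t₀ < 0 := by linarith
  have hev : ∀ᶠ s in 𝓝 t₀, W (1 * s) y = 0 := by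
    filter_upwards [Ioo_mem_nhds ht₀a ht₀b] with s hs
    rw [one_mul]
    exact hwin s hs
  exact TwoTimeTop.signal_eq_zero_of_eventually hW y one_pos ht₀0 hev

/-- The **DJ defect below `Λ`** of `W` (at the point `0`, window `(−2, −1)`): at every instant of the window the signal is
slower than `Λ` NOW or one lag EARLIER. -/
def DisjointDefectBelow (θ Λ : ℝ) (W : ℝ → E3 → E3) : Prop :=
  ∀ t ∈ Ioo (-2 : ℝ) (-1), ‖W ((1 + θ) * t) 0‖ < Λ ∨ ‖W t 0‖ < Λ

/-- **THE DJ LEVEL.**  For every `M`, lag `θ > 0` and normalisation `κ > 0` there is ONE level `Λ₁ = Λ₁(M, θ, κ) > 0` such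
that every `W ∈ 𝒦_M` with `‖W(−1, 0)‖ ≥ κ` is, at SOME instant `t ∈ (−2, −1)`, at least `Λ₁`-fast at the point `0` BOTH at
`t` AND one lag earlier, at `(1+θ)t`.  Socket lemma + windowed kill; `Λ₁` is ineffective. -/
theorem exists_disjointLevel (M θ : ℝ) (hθ : 0 < θ) {κ : ℝ} (hκ : 0 < κ) :
    ∃ Λ₁ : ℝ, 0 < Λ₁ ∧ ∀ W : ℝ → E3 → E3, IsTypeIAncientMild M W → κ ≤ ‖W (-1) 0‖ →
      ∃ t ∈ Ioo (-2 : ℝ) (-1), Λ₁ ≤ ‖W ((1 + θ) * t) 0‖ ∧ Λ₁ ≤ ‖W t 0‖ := by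
  have hκθ : 0 < 1 + θ := by linarith
  obtain ⟨Λ₁, hΛ₁, hno⟩ := exists_level_of_limitKill M hκ (DisjointDefectBelow θ) (by
    -- the limit kill: defect `< εₙ → 0` along a pointwise convergent sequence ⇒ the limit rests on the window
    intro Wn W ε hεpos hεlim hWn hW hP hpt
    have hwin : ∀ t ∈ Ioo (-2 : ℝ) (-1), W ((1 + θ) * t) 0 = 0 ∨ W t 0 = 0 := by
      intro t ht
      have ht0 : t < 0 := by linarith [ht.2]
      have ht0' : (1 + θ) * t < 0 := mul_neg_of_pos_of_neg hκθ ht0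
      have hm : Tendsto (fun n => min ‖Wn n ((1 + θ) * t) 0‖ ‖Wn n t 0‖) atTop
          (𝓝 (min ‖W ((1 + θ) * t) 0‖ ‖W t 0‖)) :=
        ((hpt _ ht0' 0).norm).min ((hpt t ht0 0).norm)
      have hle : min ‖W ((1 + θ) * t) 0‖ ‖W t 0‖ ≤ 0 := by
        refine le_of_tendsto_of_tendsto hm hεlim (Eventually.of_forall fun n => ?_)
        rcases hP n t ht with h1 | h2
        · exact (min_le_left _ _).trans h1.le
        · exact (min_le_right _ _).trans h2.le
      rcases le_total ‖W ((1 + θ) * t) 0‖ ‖W t 0‖ with hc | hc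
      · left
        rw [min_eq_left hc] at hle
        exact norm_le_zero_iff.1 hle
      · right
        rw [min_eq_right hc] at hle
        exact norm_le_zero_iff.1 hle
    exact signal_eq_zero_of_disjoint_window hW hθ 0 (by norm_num : (-2 : ℝ) < -1) (by norm_num) hwin
      (-1) (by norm_num))
  refine ⟨Λ₁, hΛ₁, fun W hW hκW => ?_⟩
  have h := hno W hW hκW
  unfold DisjointDefectBelow at h
  push Not at h
  exact h

end Summit.NavierStokesRegularity.NavierStokesRegularity.Theorems.ScenarioCensus.OneLevelTop

end
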